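import Summits.NavierStokesRegularity.NavierStokesRegularity.Theses.RossbyDichotomy
import HarnessLib.Audit

/-!
# Birth skeleton (BC3) of the crux `RossbyDichotomy.SingularMaximaElliptic`

(crux item `stmt-NavierStokesRegularity-2921`, rank 3, route `route-NavierStokesRegularity-RossbyDichotomy`;
tree path `Cruxes/SingularMaximaElliptic/Lines/birth.lean`; registrar
`planner-skel-stmt-NavierStokesRegularity-2921-0`, 2026-08-17. The route predates the Lean birth
certificate; this file supplies BC3 retroactively. At registration the crux has NO workfiles
(`ledger crux ls`: none) — no `Disproof.lean`, no crux ideas, no earlier lines — so there is no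
disprover obligation (`_false_without_`) to honour yet; `ledger negatives --problem NavierStokesRegularity`
(4 entries: SymmetryModuliCount 4055, PerpetualPump 1832, AdiabaticEddy 1429, Blowup 0154) has nothing on
the Okubo–Weiss type of vorticity maxima.)

THE CRUX (C2, the card's HAND-OVER branch as an a-priori statement). For `ν > 0`, `T > 0` and a classical
NS solution `(u,p)` on `ℝ³ × [0,T)`, Leray–Hopf from a rapidly decaying datum, with NO smooth extension
past `T`: there is `t₀ < T` such that for all `t ∈ [t₀,T)` every maximum point `x` of `|curl u(t,·)|` is
ELLIPTIC — `∀ unit e, |⟪e, Du(t,x) e⟫| ≤ ½ ‖curl u(t,x)‖` (local Rossby number `‖S‖_op/‖ω‖ ≤ ½`, the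
operator-norm Okubo–Weiss threshold).

THE CUT ("roll-up completes" ∧ "no re-sheeting", through a NAMED INTERFACE STATE). Write
`M(s) = sup |ω(s,·)|`. Call an instant `s` a ROTATION-DOMINATED-CORE instant if every point of the
factor-2 vorticity window `{x : |ω(s,y)| ≤ 2|ω(s,x)| ∀ y} = {|ω(s,x)| ≥ ½ M(s)}` is elliptic — the whole
intense region, not only the maximum points, is rotation-dominated (the route header's own window:
"Gaussian column: self-induced strain inside the factor-2 vorticity window ≤ 0.11 ω_max", NUMBERS). Near
a singular time `M(s)` is unbounded, so at high instants the window contains only the singular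
structure(s), never the bounded background: the interface state is a statement about the geometry of the
blow-up core. The two stubs are the two halves of the card's narrative, each refutable by a DIFFERENT
blow-up scenario, neither a consequence of the other, and only the second a consequence of the crux:

* `stub_rotationDominatedCoreRecurs` [XL, OPEN — "roll-up completes", the Kelvin–Helmholtz hand-over
  branch]: for a singular solution, rotation-dominated-core instants ACCUMULATE at `T`
  (`∀ t₀ < T ∃ s ∈ [t₀,T)` with the factor-2 window elliptic). Why plausibly true: a maximum under
  dominant strain is sheet-like and rolls up (BeronovKida1996, KH instability of strained layers;
  BrennerHormozPumir2016: sheets roll into tubes), and an intense rolled-up tube of circulation Reynolds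
  number `Re_Γ ≳ 90` has its whole factor-2 window elliptic (Gaussian core: self-induced `Ro ≤ 0.22`
  inside the window, `0` on the axis; external strain `γ ≤ 0.14 ω_max`); numerically, intense vorticity
  is tube-like with strain depleted in the cores (HamlingtonSchumacherDahm2008, BuariaPumirBodenschatz2020).
  Why it might fail: a blow-up whose intense region ALWAYS contains a strain-dominated part (a sheet-type
  or flattening-core singularity: HouLi2006 / Hou2022 geometries) refutes it. NOT implied by the crux
  (the crux constrains maximum points only). Cheapest falsifier: Okubo–Weiss audit of the factor-2 window
  of Hou's 2022 near-singular profile.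
* `stub_coreStateLocksMaxima` [XL, OPEN — "no re-sheeting", the Coriolis self-stabilisation branch as an
  a-priori statement]: for a singular solution there is `t₁ < T` such that from any rotation-dominated-core
  instant `s ∈ [t₁,T)` on, every maximum point stays elliptic up to `T`. Why plausibly true: a
  rotation-dominated core is locally 2D-3C and Coriolis-stabilised (BabinMahalovNicolaenko2001 localised;
  GallayMaekawa2010, Maekawa2011: stability of the Burgers vortex, high-rotation limit;
  BedrossianGermainHarropgriffiths2023: vortex filament stability), and near `T` the window IS the dominant
  core, which nothing bounded can overtake. Why it might fail: the iterated cascade tube → flattening →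
  sheet → roll-up (BrennerHormozPumir2016), or any discretely self-similar blow-up whose profile passes
  through a rotation-dominated-core phase and a hyperbolic-maximum phase each period. Implied by the crux
  (take `t₁ = t₀`), used toward it. Its hypothesis has INTERIOR (an open intense region is elliptic), which
  a stability argument can use — unlike ellipticity at the maximum points alone, which carries no
  neighbourhood information; this is why the interface is the window state and not the crux's own
  max-point state (the max-point split "elliptic instants recur ∧ ellipticity absorbing" would be the
  generic temporal identity `eventually P ⟺ recurrent P ∧ absorbing P`, with an unusable second half).

The interface constant `2` is the route header's factor-2 window, not a new threshold: any fixed factor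
`> 1` gives the same composition, and moving it trades strength between the two stubs (checklist 4c(iv)
noted). Both stubs are conditioned on `¬ HasSmoothExtensionPast` (as the crux is), so the decaying-regime
witness recorded against the sibling item `HandOverTime` (stmt-2922, suspect-false via
FujigakiMiyakawa2001 / GallayWayne2002 asymptotics of GLOBAL decaying solutions) instantiates neither.

`SingularMaximaElliptic_of : SingularMaximaElliptic` is the ONLY theorem of this file concluding the crux
(A12 layer invariant of `ledger skeleton check`: conclusion = the crux BY NAME, no `Prop` hypotheses,
`sorry` only inside the two declared stubs, which it uses by name); it is the real composition: `t₁` from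
stub 2, a rotation-dominated-core instant `s ∈ [t₁,T)` from stub 1, then stub 2 from `s` on; answer
`t₀ := s`. Its CLOSED twin with the stub STATEMENTS as hypotheses,
`SingularMaximaElliptic_of_hyps : <sig 1> → <sig 2> → SingularMaximaElliptic` (same proof, no placeholder
anywhere, axioms `propext / Classical.choice / Quot.sound`), is the registrar's evidence file
`bc/SingularMaximaElliptic_birth_closed.lean`.

BC3 PROBES (registrar folder `bc/probe_*.lean`): for each stub `S`, `S → SingularMaximaElliptic` and
`S → NavierStokesRegularity` by `first | exact? | simpa | aesop` FAIL (quoted in `Lines/birth.md`): no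
stub is cheaply the crux or the summit. Stub 1 is `∀ t₀ ∃ s` about the window state (independent of the
crux); stub 2 needs a window-elliptic instant that only stub 1 supplies.
-/

noncomputable section

open Set

namespace Summit.NavierStokesRegularity.NavierStokesRegularity.Cruxes.SingularMaximaElliptic.Birth

set_option linter.unusedVariables false
set_option linter.dupNamespace false

/-- **stub 1 — `stub_rotationDominatedCoreRecurs` (XL; OPEN — "roll-up completes": the Kelvin–Helmholtz
hand-over branch; BeronovKida1996, BrennerHormozPumir2016, HamlingtonSchumacherDahm2008).** For `ν > 0`,
`T > 0` and a classical NS solution on `ℝ³ × [0,T)`, Leray–Hopf from a rapidly decaying datum, with no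
smooth extension past `T`: for every `t₀ ∈ [0,T)` there is an instant `s ∈ [t₀,T)` at which every point
`x` of the factor-2 vorticity window (`‖curl u(s,y)‖ ≤ 2‖curl u(s,x)‖` for all `y`) is elliptic:
`∀ unit e, |⟪e, Du(s,x) e⟫| ≤ ½‖curl u(s,x)‖`. (Rotation-dominated-core instants accumulate at a singular
time.) NOT a consequence of the crux, which constrains maximum points only. -/
theorem stub_rotationDominatedCoreRecurs :
    ∀ (ν T : ℝ), 0 < ν → 0 < T →
      ∀ (u : ℝ → EuclideanSpace ℝ (Fin 3) → EuclideanSpace ℝ (Fin 3))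
        (p : ℝ → EuclideanSpace ℝ (Fin 3) → ℝ),
        Literature.Analysis.FluidPDE.IsClassicalNSSolutionOn (Set.Ico 0 T) ν 0 u p →
        Literature.Analysis.FluidPDE.IsLerayHopfOn T ν 0 (u 0) u →
        Literature.Analysis.FluidPDE.HasRapidSpatialDecay (u 0) →
        ¬ Literature.Analysis.FluidPDE.HasSmoothExtensionPast ν 0 u T →
        ∀ t₀ ∈ Set.Ico 0 T, ∃ s ∈ Set.Ico t₀ T, ∀ x : EuclideanSpace ℝ (Fin 3),
          (∀ y, ‖Literature.Analysis.FluidPDE.curl (u s) y‖ ≤ 2 * ‖Literature.Analysis.FluidPDE.curl (u s) x‖) →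
          ∀ e : EuclideanSpace ℝ (Fin 3), ‖e‖ = 1 →
            |inner ℝ e (fderiv ℝ (u s) x e)| ≤ (1 / 2 : ℝ) * ‖Literature.Analysis.FluidPDE.curl (u s) x‖ := by
  sorry

/-- **stub 2 — `stub_coreStateLocksMaxima` (XL; OPEN — "no re-sheeting": the Coriolis self-stabilisation
branch as an a-priori statement on singular solutions; BabinMahalovNicolaenko2001 localised,
GallayMaekawa2010, Maekawa2011, BedrossianGermainHarropgriffiths2023; fails under the BrennerHormozPumir2016
cascade).** For `ν > 0`, `T > 0` and a classical NS solution on `ℝ³ × [0,T)`, Leray–Hopf from a rapidly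
decaying datum, with no smooth extension past `T`: there is `t₁ ∈ [0,T)` such that for every instant
`s ∈ [t₁,T)` at which every point of the factor-2 vorticity window is elliptic, every maximum point of
`|curl u(t,·)|` is elliptic for all `t ∈ [s,T)`. (Near a singular time a rotation-dominated core, once
formed, keeps the vorticity maxima elliptic until `T`.) A consequence of the crux (take `t₁ = t₀`), used
toward it; its hypothesis is an open-region condition a stability argument can start from. -/
theorem stub_coreStateLocksMaxima :
    ∀ (ν T : ℝ), 0 < ν → 0 < T →
      ∀ (u : ℝ → EuclideanSpace ℝ (Fin 3) → EuclideanSpace ℝ (Fin 3))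
        (p : ℝ → EuclideanSpace ℝ (Fin 3) → ℝ),
        Literature.Analysis.FluidPDE.IsClassicalNSSolutionOn (Set.Ico 0 T) ν 0 u p →
        Literature.Analysis.FluidPDE.IsLerayHopfOn T ν 0 (u 0) u →
        Literature.Analysis.FluidPDE.HasRapidSpatialDecay (u 0) →
        ¬ Literature.Analysis.FluidPDE.HasSmoothExtensionPast ν 0 u T →
        ∃ t₁ ∈ Set.Ico 0 T, ∀ s ∈ Set.Ico t₁ T,
          (∀ x : EuclideanSpace ℝ (Fin 3),
            (∀ y, ‖Literature.Analysis.FluidPDE.curl (u s) y‖ ≤ 2 * ‖Literature.Analysis.FluidPDE.curl (u s) x‖) →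
            ∀ e : EuclideanSpace ℝ (Fin 3), ‖e‖ = 1 →
              |inner ℝ e (fderiv ℝ (u s) x e)| ≤ (1 / 2 : ℝ) * ‖Literature.Analysis.FluidPDE.curl (u s) x‖) →
          ∀ t ∈ Set.Ico s T, ∀ x : EuclideanSpace ℝ (Fin 3),
            (∀ y, ‖Literature.Analysis.FluidPDE.curl (u t) y‖ ≤ ‖Literature.Analysis.FluidPDE.curl (u t) x‖) →
            ∀ e : EuclideanSpace ℝ (Fin 3), ‖e‖ = 1 →
              |inner ℝ e (fderiv ℝ (u t) x e)| ≤ (1 / 2 : ℝ) * ‖Literature.Analysis.FluidPDE.curl (u t) x‖ := by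
  sorry

/-- **Birth composition (the skeleton theorem).** The crux BY NAME from the two registered stubs, used by
name: `t₁` from stub 2; a rotation-dominated-core instant `s ∈ [t₁,T)` from stub 1 (applied at
`t₀ := t₁`); stub 2 from `s` on makes every maximum point elliptic on `[s,T)`; answer `t₀ := s`
(`s ∈ [0,T)` because `0 ≤ t₁ ≤ s`). The same proof with the stub STATEMENTS as hypotheses (closed,
axioms `propext / Classical.choice / Quot.sound`) is the registrar's evidence file
`bc/SingularMaximaElliptic_birth_closed.lean`. -/
theorem SingularMaximaElliptic_of : Theses.RossbyDichotomy.SingularMaximaElliptic := by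
  have hrec := stub_rotationDominatedCoreRecurs
  have hlock := stub_coreStateLocksMaxima
  intro ν T hν hT u p hcl hLH hdec hsing
  -- stub 2: the locking time t₁
  obtain ⟨t₁, ht₁, hlock₁⟩ := hlock ν T hν hT u p hcl hLH hdec hsing
  -- stub 1: a rotation-dominated-core instant s ∈ [t₁, T)
  obtain ⟨s, hs, hcore⟩ := hrec ν T hν hT u p hcl hLH hdec hsing t₁ ht₁
  -- from s on, every maximum point is elliptic
  refine ⟨s, ⟨le_trans ht₁.1 hs.1, hs.2⟩, ?_⟩
  intro t ht x hx e he
  exact hlock₁ s hs hcore t ht x hx e he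

end Summit.NavierStokesRegularity.NavierStokesRegularity.Cruxes.SingularMaximaElliptic.Birth
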